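import Summits.HubbardSuperconductivity.HubbardSuperconductivity.Theorems.JosephsonMirrorJmPairBridgeIrreducibleOnIntervals
import HarnessLib

/-!
# Crux `JmCusp` (stmt-HubbardSuperconductivity-2228), line `cocountable-coupling-selection`:
# the degenerate-floor couplings are finitely many once the simple-floor couplings are dense

Route `JosephsonMirror`, crux `JmCusp`, stub `stub_pencilFiniteness` of the checked line
`cocountable-coupling-selection` (sub-problem `HubbardSuperconductivity`).

Fix a torus side `L`, a doping `δ` (hence the particle number `N = 2⌊(1 - δ)L²/2⌋`) and look at the
`(N, S^z = 0)` ground floor `F(U) = szSector N 0 ⊓ eigenspace (hubbardTorus 2 L 1 U) (min energy)` of the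
affine Hermitian pencil `U ↦ hubbardTorus 2 L 1 U = H₀ + U · Σ_x n_{x↑} n_{x↓}`.  "The floor is simple at `U`"
(any two sector ground states are proportional) is the statement `dim F(U) ≤ 1`
(`pencilFiniteness_simple_iff_finrank_le_one`).  This file proves:

* `pencilFiniteness_finrank_locallyConstant` — near a NON-EXCEPTIONAL coupling `U₀` (one with the maximal
  number of distinct eigenvalues) the floor dimension is locally constant: `≤` by the injective orthogonal
  compression `stub_floorUpper`, `≥` by `stub_floorLower` fed with `stub_noSplitNearGeneric` and
  `stub_floorGap` (the `dim`-twin of `irreducibilityLocallyConstant`, same set-up verbatim);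
* `pencilFiniteness_finrank_const_on_preconnected`, `pencilFiniteness_exists_finset_finrank_const` — hence
  the floor dimension is constant along every preconnected set of non-exceptional couplings, and the
  exceptional couplings form a FINITE set (Hermite–Sylvester, `exists_finset_forall_card_roots_le`);
* `stub_pencilFiniteness` — so if the simple-floor couplings are dense in a window `(a, b)`, every
  non-exceptional coupling of the window is simple (it sits in an open sub-interval of `(a, b)` avoiding the
  exceptional set, which contains a simple coupling), i.e. the degenerate-floor couplings of the window lie
  in the finite exceptional set.

Sources: T. Kato, *Perturbation Theory for Linear Operators* (1966), Ch. II §§1.1, 5.1 (algebraic structure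
of the eigenvalues of an affine symmetric pencil; continuity of the total eigenprojection); H. Tasaki,
*Physics and Mathematics of Quantum Many-Body Systems* (2020) §2.1. No definition, no named fact.
-/

noncomputable section

-- the mandated namespace `Summit.<Summit>.<Problem>.Theorems` repeats `HubbardSuperconductivity`
-- (single-problem summit, D-0017), which the `dupNamespace` linter flags on every declaration
set_option linter.dupNamespace false

namespace Summit.HubbardSuperconductivity.HubbardSuperconductivity.Theorems.JosephsonMirror

open Matrix Literature.MathematicalPhysics.QuantumLattice Literature.Probability.LatticeModels
open Literature.MathematicalPhysics.QuantumLattice.EigenvalueContinuation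
open scoped ComplexOrder

/-- **Simplicity of the sector ground floor is `dim ≤ 1`.** For a matrix `H` on the Fock space, a particle
number `N` and a magnetisation `M`, any two `(N, M)`-sector ground states of `H` (non-zero vectors of the
floor `szSector N M ⊓ eigenspace H (minEnergyOn)`) are proportional iff the floor has dimension at most one
(`finrank_le_one_iff`). Tasaki (2020) §2.1. [folklore] -/
theorem pencilFiniteness_simple_iff_finrank_le_one {Λ : Type*} [LinearOrder Λ] [Fintype Λ]
    (H : Matrix (Finset (Orb Λ)) (Finset (Orb Λ)) ℂ) (N : ℕ) (M : ℝ) :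
    (∀ φ φ' : Fock (Orb Λ), IsGroundStateInSector H N M φ → IsGroundStateInSector H N M φ' →
        ∃ c : ℂ, φ' = c • φ) ↔
      Module.finrank ℂ ↥(szSector N M ⊓ Module.End.eigenspace (Matrix.toLin' H)
        (((H.minEnergyOn (szSector N M) : ℝ)) : ℂ)) ≤ 1 := by
  classical
  -- the sector ground states are the non-zero vectors of the floor
  have hmem : ∀ φ : Fock (Orb Λ), IsGroundStateInSector H N M φ ↔
      φ ∈ szSector N M ⊓ Module.End.eigenspace (Matrix.toLin' H)
        (((H.minEnergyOn (szSector N M) : ℝ)) : ℂ) ∧ φ ≠ 0 := fun φ => by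
    rw [Submodule.mem_inf, Module.End.mem_eigenspace_iff, Matrix.toLin'_apply]
    exact ⟨fun h => ⟨⟨h.1, h.2.2⟩, h.2.1⟩, fun h => ⟨h.1.1, h.2, h.1.2⟩⟩
  rw [finrank_le_one_iff]
  constructor
  · intro h
    by_cases hex : ∃ v ∈ szSector N M ⊓ Module.End.eigenspace (Matrix.toLin' H)
        (((H.minEnergyOn (szSector N M) : ℝ)) : ℂ), v ≠ 0
    · obtain ⟨v, hvF, hv0⟩ := hex
      refine ⟨⟨v, hvF⟩, fun w => ?_⟩
      by_cases hw0 : (w : Fock (Orb Λ)) = 0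
      · refine ⟨0, Subtype.ext ?_⟩
        rw [zero_smul, hw0, Submodule.coe_zero]
      · obtain ⟨c, hc⟩ := h v w ((hmem v).2 ⟨hvF, hv0⟩) ((hmem w).2 ⟨w.2, hw0⟩)
        refine ⟨c, Subtype.ext ?_⟩
        rw [Submodule.coe_smul, hc]
    · push Not at hex
      refine ⟨0, fun w => ⟨0, ?_⟩⟩
      rw [smul_zero]
      exact Subtype.ext (hex w w.2).symm
  · rintro ⟨v, hv⟩ φ φ' hφ hφ'
    obtain ⟨hφF, hφ0⟩ := (hmem φ).1 hφ
    obtain ⟨hφ'F, -⟩ := (hmem φ').1 hφ'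
    obtain ⟨a, ha⟩ := hv ⟨φ, hφF⟩
    obtain ⟨b, hb⟩ := hv ⟨φ', hφ'F⟩
    have ha' : a • (v : Fock (Orb Λ)) = φ := congrArg Subtype.val ha
    have hb' : b • (v : Fock (Orb Λ)) = φ' := congrArg Subtype.val hb
    have ha0 : a ≠ 0 := by
      rintro rfl
      exact hφ0 (by rw [← ha', zero_smul])
    refine ⟨b / a, ?_⟩
    rw [← ha', ← hb', smul_smul, div_mul_cancel₀ b ha0]

/-- **The floor dimension is locally constant near a non-exceptional coupling.** For the torus side `L`,
a particle number `N` and a coupling `U₀` at which the number of distinct eigenvalues of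
`hubbardTorus 2 L 1 U₀` is maximal over all real couplings, the `(N, 0)` ground floor at every coupling
`u` near `U₀` has the same dimension as the floor at `U₀`: `≤` by the injective orthogonal compression
(`stub_floorUpper`, from the strict gap `stub_floorGap` at `U₀`), `≥` because no eigenvalue splits off
near a non-exceptional coupling (`stub_floorLower`, `stub_noSplitNearGeneric`). Kato (1966) II §§1.1,
5.1; Tasaki (2020) §2.1. [folklore] -/
theorem pencilFiniteness_finrank_locallyConstant (L : ℕ) [NeZero L] (N : ℕ) (U₀ : ℝ)
    (hgen : ∀ u' : ℝ, (hubbardTorus 2 L 1 u').charpoly.roots.toFinset.card ≤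
      (hubbardTorus 2 L 1 U₀).charpoly.roots.toFinset.card) :
    ∃ ε : ℝ, 0 < ε ∧ ∀ u ∈ Set.Ioo (U₀ - ε) (U₀ + ε),
      Module.finrank ℂ ↥(szSector N 0 ⊓ Module.End.eigenspace (Matrix.toLin' (hubbardTorus 2 L 1 u))
          (((hubbardTorus 2 L 1 u).minEnergyOn (szSector N 0) : ℝ) : ℂ)) =
        Module.finrank ℂ ↥(szSector N 0 ⊓ Module.End.eigenspace (Matrix.toLin' (hubbardTorus 2 L 1 U₀))
          (((hubbardTorus 2 L 1 U₀).minEnergyOn (szSector N 0) : ℝ) : ℂ)) := by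
  classical
  -- the family, the sector, the sector energies
  set H : ℝ → Matrix (Finset (Orb (FermionTorus 2 L))) (Finset (Orb (FermionTorus 2 L))) ℂ :=
    fun u => hubbardTorus 2 L 1 u
  set K : Submodule ℂ (Fock (Orb (FermionTorus 2 L))) := szSector N 0
  set m : ℝ → ℝ := fun u => (hubbardTorus 2 L 1 u).minEnergyOn (szSector N 0)
  have hmu : ∀ u, m u = (H u).minEnergyOn K := fun u => rfl
  -- degenerate case: the sector has no unit vector, every floor is `⊥`
  by_cases hK : ∃ ψ ∈ K, star ψ ⬝ᵥ ψ = 1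
  swap
  · have hbot : ∀ u' : ℝ,
        K ⊓ Module.End.eigenspace (Matrix.toLin' (H u')) ((m u' : ℝ) : ℂ) = ⊥ := by
      intro u'
      rw [Submodule.eq_bot_iff]
      intro w hw
      by_contra hw0
      obtain ⟨c, -, -, hunit⟩ := exists_normalize hw0
      exact hK ⟨(c : ℂ) • w, K.smul_mem _ (Submodule.mem_inf.mp hw).1, hunit⟩
    have hzero : ∀ u' : ℝ,
        Module.finrank ℂ ↥(K ⊓ Module.End.eigenspace (Matrix.toLin' (H u')) ((m u' : ℝ) : ℂ)) = 0 :=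
      fun u' => by rw [hbot u', finrank_bot]
    exact ⟨1, one_pos, fun u _ => (hzero u).trans (hzero U₀).symm⟩
  -- the abstract data of the pencil `u ↦ H u` on the invariant sector `K`
  have hherm : ∀ u, (H u)ᴴ = H u := fun u =>
    (LiebThm1.hamiltonian_isHermitian (fermionTorusGraph 2 L) 1 u).eq
  have hinv : ∀ u, ∀ v ∈ K, H u *ᵥ v ∈ K := fun u v hv =>
    Literature.MathematicalPhysics.QuantumLattice.hubbardTorus_mulVec_mem_szSector 1 u hv
  have hlip : ∀ (u u' : ℝ) (v : Fock (Orb (FermionTorus 2 L))),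
      |(star v ⬝ᵥ H u *ᵥ v).re - (star v ⬝ᵥ H u' *ᵥ v).re| ≤
        (Fintype.card (FermionTorus 2 L) : ℝ) * |u - u'| * (star v ⬝ᵥ v).re :=
    fun u u' v => abs_re_expect_hamiltonian_sub_le (fermionTorusGraph 2 L) 1 u u' v
  have hm : ∀ (u : ℝ), ∀ v ∈ K, m u * (star v ⬝ᵥ v).re ≤ (star v ⬝ᵥ H u *ᵥ v).re :=
    fun u v hv => minEnergyOn_mul_re_le (H u) K hv
  have hatt : ∀ u : ℝ, ∃ ψ ∈ K, ψ ≠ 0 ∧ H u *ᵥ ψ = (m u : ℂ) • ψ := by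
    intro u
    obtain ⟨ψ₀, hψ₀K, hψ₀⟩ := hK
    have hne : {w : Fock (Orb (FermionTorus 2 L)) | w ∈ K ∧ star w ⬝ᵥ w = 1}.Nonempty :=
      ⟨ψ₀, hψ₀K, hψ₀⟩
    obtain ⟨w, hw, hmin⟩ :=
      (isCompact_unitSphere_inter K).exists_isMinOn hne (continuous_energy (H u)).continuousOn
    have hwle : (star w ⬝ᵥ H u *ᵥ w).re ≤ m u * (star w ⬝ᵥ w).re := by
      rw [hw.2, Complex.one_re, mul_one, hmu u, Matrix.minEnergyOn]
      refine le_csInf ⟨_, w, hw.1, hw.2, rfl⟩ ?_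
      rintro E ⟨ψ, hψK, hψ1, rfl⟩
      exact (isMinOn_iff.mp hmin) ψ ⟨hψK, hψ1⟩
    have hw0 : w ≠ 0 := by
      rintro rfl
      have h := hw.2
      rw [dotProduct_zero] at h
      exact zero_ne_one h
    exact ⟨w, hw.1, hw0, mulVec_eq_smul_of_forall_le_on (hherm u) K (hinv u) (hm u) hw.1 hwle⟩
  -- the strict gap above the floor at every coupling, continuity of the pencil
  have hgapAll : ∀ u : ℝ, ∃ μ : ℝ, m u < μ ∧
      (∀ w ∈ K, (∀ ψ ∈ K, H u *ᵥ ψ = (m u : ℂ) • ψ → star ψ ⬝ᵥ w = 0) →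
        μ * (star w ⬝ᵥ w).re ≤ (star w ⬝ᵥ H u *ᵥ w).re) ∧
      ((∀ w ∈ K, (∀ ψ ∈ K, H u *ᵥ ψ = (m u : ℂ) • ψ → star ψ ⬝ᵥ w = 0) → w = 0) ∨
        (∃ φ ∈ K, φ ≠ 0 ∧ (∀ ψ ∈ K, H u *ᵥ ψ = (m u : ℂ) • ψ → star ψ ⬝ᵥ φ = 0) ∧
          H u *ᵥ φ = (μ : ℂ) • φ)) :=
    fun u => stub_floorGap (H u) (hherm u) K (hinv u) (m u) (hm u)
  have hcont : Continuous H := by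
    have hpen : H = fun u : ℝ => hubbardTorus 2 L 1 0 +
        ((u : ℝ) : ℂ) • ∑ x : FermionTorus 2 L, numberOp x 0 * numberOp x 1 := by
      funext u
      exact hamiltonian_eq_add_smul_doublon (fermionTorusGraph 2 L) 1 u
    rw [hpen]
    exact continuous_const.add (Complex.continuous_ofReal.smul continuous_const)
  -- no splitting near the non-exceptional `U₀`; the two semicontinuities of the floor dimension
  obtain ⟨ρ, hρ, hns⟩ := stub_noSplitNearGeneric H
    (fun u => LiebThm1.hamiltonian_isHermitian (fermionTorusGraph 2 L) 1 u) hcont U₀ hgen (m U₀)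
    (by obtain ⟨ψ, -, hψ0, hψ⟩ := hatt U₀; exact ⟨ψ, hψ0, hψ⟩)
  obtain ⟨μ₀, hμ₀, hgap₀, -⟩ := hgapAll U₀
  obtain ⟨ε₁, hε₁, hup⟩ := stub_floorUpper H hherm K hinv _ (Nat.cast_nonneg _) hlip m hm hatt U₀ μ₀
    hμ₀ hgap₀
  obtain ⟨ε₂, hε₂, hlow⟩ := stub_floorLower H hherm K hinv _ (Nat.cast_nonneg _) hlip m hm hatt
    hgapAll U₀ ρ hρ hns
  refine ⟨min ε₁ ε₂, lt_min hε₁ hε₂, fun u hu => ?_⟩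
  have hu' : |u - U₀| < min ε₁ ε₂ := by
    rw [abs_lt]
    constructor <;> linarith [hu.1, hu.2]
  obtain ⟨-, hle⟩ := hup u (lt_of_lt_of_le hu' (min_le_left _ _))
  have hge := hlow u (lt_of_lt_of_le hu' (min_le_right _ _))
  exact le_antisymm hle hge

/-- **The floor dimension is constant along preconnected sets of non-exceptional couplings.** For the
torus side `L`, a particle number `N` and a preconnected set `S` of couplings at each of which the number of
distinct eigenvalues of `hubbardTorus 2 L 1 U` is maximal, the `(N, 0)` ground floor has the same dimension
at any two couplings of `S` (the dimension is locally constant on `S` by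
`pencilFiniteness_finrank_locallyConstant`, hence continuous into the discrete space `ℕ`, hence constant on
the preconnected `S`). Kato (1966) II §5.1. [folklore] -/
theorem pencilFiniteness_finrank_const_on_preconnected (L : ℕ) [NeZero L] (N : ℕ) (S : Set ℝ)
    (hS : IsPreconnected S)
    (hgen : ∀ U ∈ S, ∀ u' : ℝ, (hubbardTorus 2 L 1 u').charpoly.roots.toFinset.card ≤
      (hubbardTorus 2 L 1 U).charpoly.roots.toFinset.card) :
    ∀ U ∈ S, ∀ U' ∈ S,
      Module.finrank ℂ ↥(szSector N 0 ⊓ Module.End.eigenspace (Matrix.toLin' (hubbardTorus 2 L 1 U))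
          (((hubbardTorus 2 L 1 U).minEnergyOn (szSector N 0) : ℝ) : ℂ)) =
        Module.finrank ℂ ↥(szSector N 0 ⊓ Module.End.eigenspace (Matrix.toLin' (hubbardTorus 2 L 1 U'))
          (((hubbardTorus 2 L 1 U').minEnergyOn (szSector N 0) : ℝ) : ℂ)) := by
  classical
  -- the floor dimension as a function of the coupling
  let f : ℝ → ℕ := fun u =>
    Module.finrank ℂ ↥(szSector N 0 ⊓ Module.End.eigenspace (Matrix.toLin' (hubbardTorus 2 L 1 u))
      (((hubbardTorus 2 L 1 u).minEnergyOn (szSector N 0) : ℝ) : ℂ))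
  have hf : ContinuousOn f S := by
    intro U hU
    obtain ⟨ε, hε, hloc⟩ := pencilFiniteness_finrank_locallyConstant L N U (hgen U hU)
    have hev : f =ᶠ[nhds U] fun _ => f U := by
      filter_upwards [Ioo_mem_nhds (show U - ε < U by linarith) (show U < U + ε by linarith)]
        with u hu
      exact hloc u hu
    exact hev.continuousAt.continuousWithinAt
  intro U hU U' hU'
  exact hS.constant hf hU hU'

/-- **Finitely many exceptional couplings.** At a fixed torus side `L` and particle number `N` there is a
FINITE set `E` of exceptional couplings (Hermite–Sylvester: `exists_finset_forall_card_roots_le` for the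
affine Hermitian pencil `hubbardTorus 2 L 1 U = H₀ + U · Σ_x n_{x↑} n_{x↓}`) such that along every
preconnected set of couplings avoiding `E` the `(N, 0)` ground floor has constant dimension.
Kato (1966) II §§1.1, 5.1. [folklore] -/
theorem pencilFiniteness_exists_finset_finrank_const (L : ℕ) [NeZero L] (N : ℕ) :
    ∃ E : Finset ℝ, ∀ S : Set ℝ, IsPreconnected S → (∀ u ∈ S, u ∉ E) →
      ∀ U ∈ S, ∀ U' ∈ S,
        Module.finrank ℂ ↥(szSector N 0 ⊓ Module.End.eigenspace (Matrix.toLin' (hubbardTorus 2 L 1 U))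
            (((hubbardTorus 2 L 1 U).minEnergyOn (szSector N 0) : ℝ) : ℂ)) =
          Module.finrank ℂ ↥(szSector N 0 ⊓
            Module.End.eigenspace (Matrix.toLin' (hubbardTorus 2 L 1 U'))
              (((hubbardTorus 2 L 1 U').minEnergyOn (szSector N 0) : ℝ) : ℂ)) := by
  have hpen : ∀ u : ℝ, hubbardTorus 2 L 1 u = hubbardTorus 2 L 1 0 +
      ((u : ℝ) : ℂ) • ∑ x : FermionTorus 2 L, numberOp x 0 * numberOp x 1 := fun u =>
    hamiltonian_eq_add_smul_doublon (fermionTorusGraph 2 L) 1 u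
  have hT : (hubbardTorus 2 L 1 0).IsHermitian :=
    LiebThm1.hamiltonian_isHermitian (fermionTorusGraph 2 L) 1 0
  have hD : (∑ x : FermionTorus 2 L, numberOp x 0 * numberOp x 1 :
      Matrix (Finset (Orb (FermionTorus 2 L))) (Finset (Orb (FermionTorus 2 L))) ℂ).IsHermitian :=
    doublon_isHermitian
  obtain ⟨E, hE⟩ := exists_finset_forall_card_roots_le hT hD
  refine ⟨E, fun S hS hSE =>
    pencilFiniteness_finrank_const_on_preconnected L N S hS fun U hU u' => ?_⟩
  rw [hpen u', hpen U]
  exact hE U (hSE U hU) u'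

/-- **STUB `stub_pencilFiniteness`** (real-algebraic structure of the bottom of an affine Hermitian pencil,
`dim = 1` form). At a fixed torus side `L` and doping `δ`, if the couplings at which the
`(2⌊(1 - δ)L²/2⌋, S^z = 0)` ground floor of `hubbardTorus 2 L 1 U` is simple are dense in the window
`(a, b)`, then the couplings of the window at which it is NOT simple are finitely many: they lie in the
finite exceptional set `E` of `pencilFiniteness_exists_finset_finrank_const`, since a non-exceptional
coupling `U ∈ (a, b)` sits in an open sub-interval of `(a, b)` avoiding `E`, on which the floor dimension is
constant and which contains a simple coupling by density, so `dim F(U) ≤ 1`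
(`pencilFiniteness_simple_iff_finrank_le_one`). Kato (1966) II §§1.1, 5.1. [folklore] -/
theorem stub_pencilFiniteness :
    ∀ (L : ℕ) [NeZero L] (δ a b : ℝ), a < b →
      (∀ a' b' : ℝ, a ≤ a' → a' < b' → b' ≤ b → ∃ U ∈ Set.Ioo a' b', ∀ φ φ' : Literature.MathematicalPhysics.QuantumLattice.Fock (Literature.MathematicalPhysics.QuantumLattice.Orb (Literature.MathematicalPhysics.QuantumLattice.FermionTorus 2 L)), Literature.MathematicalPhysics.QuantumLattice.IsGroundStateInSector (Literature.MathematicalPhysics.QuantumLattice.hubbardTorus 2 L 1 U) (2 * ⌊(1 - δ) * (L : ℝ) ^ 2 / 2⌋₊) 0 φ → Literature.MathematicalPhysics.QuantumLattice.IsGroundStateInSector (Literature.MathematicalPhysics.QuantumLattice.hubbardTorus 2 L 1 U) (2 * ⌊(1 - δ) * (L : ℝ) ^ 2 / 2⌋₊) 0 φ' → ∃ c : ℂ, φ' = c • φ) →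
      Set.Finite {U : ℝ | U ∈ Set.Ioo a b ∧ ¬ ∀ φ φ' : Literature.MathematicalPhysics.QuantumLattice.Fock (Literature.MathematicalPhysics.QuantumLattice.Orb (Literature.MathematicalPhysics.QuantumLattice.FermionTorus 2 L)), Literature.MathematicalPhysics.QuantumLattice.IsGroundStateInSector (Literature.MathematicalPhysics.QuantumLattice.hubbardTorus 2 L 1 U) (2 * ⌊(1 - δ) * (L : ℝ) ^ 2 / 2⌋₊) 0 φ → Literature.MathematicalPhysics.QuantumLattice.IsGroundStateInSector (Literature.MathematicalPhysics.QuantumLattice.hubbardTorus 2 L 1 U) (2 * ⌊(1 - δ) * (L : ℝ) ^ 2 / 2⌋₊) 0 φ' → ∃ c : ℂ, φ' = c • φ} := by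
  intro L _ δ a b _ hdense
  classical
  obtain ⟨E, hE⟩ :=
    pencilFiniteness_exists_finset_finrank_const L (2 * ⌊(1 - δ) * (L : ℝ) ^ 2 / 2⌋₊)
  -- the degenerate-floor couplings of the window lie in the finite exceptional set `E`
  refine Set.Finite.subset E.finite_toSet ?_
  rintro U ⟨hU, hbad⟩
  by_contra hUE
  apply hbad
  -- an open interval around `U` inside `(a, b)` avoiding `E`
  have hO : IsOpen ((↑E : Set ℝ)ᶜ) := E.finite_toSet.isClosed.isOpen_compl
  obtain ⟨ε, hε, hball⟩ := Metric.isOpen_iff.1 hO U hUE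
  obtain ⟨ε', hε'pos, hε'ε, hε'a, hε'b⟩ : ∃ ε' : ℝ, 0 < ε' ∧ ε' ≤ ε ∧ a ≤ U - ε' ∧ U + ε' ≤ b := by
    refine ⟨min ε (min (U - a) (b - U)), lt_min hε (lt_min (by linarith [hU.1]) (by linarith [hU.2])),
      min_le_left _ _, ?_, ?_⟩
    · have h1 := min_le_right ε (min (U - a) (b - U))
      have h2 := min_le_left (U - a) (b - U)
      linarith
    · have h1 := min_le_right ε (min (U - a) (b - U))
      have h2 := min_le_right (U - a) (b - U)
      linarith
  have havoid : ∀ u ∈ Set.Ioo (U - ε') (U + ε'), u ∉ E := by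
    intro u hu huE
    have hmem : u ∈ Metric.ball U ε := by
      rw [Metric.mem_ball, Real.dist_eq, abs_lt]
      constructor <;> linarith [hu.1, hu.2]
    exact hball hmem huE
  -- a simple coupling `U'` of that interval; the floor dimension is the same at `U` and `U'`
  obtain ⟨U', hU', hsimple'⟩ := hdense (U - ε') (U + ε') hε'a (by linarith) hε'b
  have hUI : U ∈ Set.Ioo (U - ε') (U + ε') := ⟨by linarith, by linarith⟩
  have hconst := hE (Set.Ioo (U - ε') (U + ε')) isPreconnected_Ioo havoid U hUI U' hU'
  have h1 := (pencilFiniteness_simple_iff_finrank_le_one (hubbardTorus 2 L 1 U')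
    (2 * ⌊(1 - δ) * (L : ℝ) ^ 2 / 2⌋₊) 0).1 hsimple'
  exact (pencilFiniteness_simple_iff_finrank_le_one (hubbardTorus 2 L 1 U)
    (2 * ⌊(1 - δ) * (L : ℝ) ^ 2 / 2⌋₊) 0).2 (hconst.le.trans h1)

end Summit.HubbardSuperconductivity.HubbardSuperconductivity.Theorems.JosephsonMirror

end
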